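import Mathlib
import Literature.Analysis.FluidPDE.VectorCalculus
import Literature.Analysis.FluidPDE.ClassicalSolution
import HarnessLib

/-!
# Crux `PoloidalLiouville` (stmt-NavierStokesRegularity-1222, wall W1), crux idea «steady-centre-sieve» (ns-idea-15 g5, lens «negation»):
# the four S-statements of the card and their two objects, TYPED Theorems-side (twin of the sketch, bodies VERBATIM)

Definition file (Theorems-side twin of part of the crux workfile `Cruxes/PoloidalLiouville/CentreJetSketch.lean`, v1.1, 2026-08-28;
namespace `…Theorems.PoloidalLiouville.CentreJet` instead of the sketch's `…Cruxes.PoloidalLiouville.CentreJet`).  Scope fixed by the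
critic of record (ns-wall-crit-1 g2, 23:17:22Z caution (2)): ONLY the two objects and the four routine (S) statements whose kernel proofs
exist — bodies VERBATIM against sketch l.64 / l.68 (objects) and l.77 / l.100 / l.266 / l.301 (statements); nothing downstream of the
conjectures (in particular NOT `NoTriaxialStagnationCentre`, false as typed per V17 addendum) is twinned here.

* objects: `IsUnthreadedAbout x₀ V` (vortex lines on the spheres about `x₀`), `IsSteadyNSOn U V p` (classical steady NS on `U`);
* (E1, S) `CentreVorticityJet`, (E3, S) `CentreStrainLawAlgebra`, (R3, S) `IrrotationalSteadyLiouville`, (sanity, S) `ZonalSatisfiesStrainLaw`.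

Kernel proofs of the four bodies (verbatim, these names in lower case): `CentreJet.centreVorticityJet`
(`ThreadingFluxCentreJetVorticityJet.lean`), `CentreJet.centreStrainLawAlgebra` (`ThreadingFluxCentreJetStrainLaw.lean`),
`CentreJet.irrotationalSteadyLiouville` / `CentreJet.zonalSatisfiesStrainLaw` (`ThreadingFluxCentreJetFirstLemmas.lean`, p677698); the
by-name glue `…_holds : <Prop>` follows this file.  Purpose: by-name citation from `Theorems/` without importing a crux workfile (same
device as `ThreadingFluxHorizonTowerDefs.lean`, `UnthreadedDoorNetFluxDefs.lean`); the sketch can add `Iff.rfl` guards at its next version.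

WHAT THIS IS NOT: no NS-regularity statement is touched; `PoloidalLiouville` (1222), the card's conjectures (C1, C1*, C1′-repair) and its
target `SteadyUnthreadedLiouville` stay OPEN; information-grade.  `--supports stmt-NavierStokesRegularity-1222 --as helper`.  Author of the
statements: planner ns-idea-15 g5; filed Theorems-side by ns-wall-eng-7 g4 (cell ns-wall-extremal).
[cite: MajdaBertozziCUP2002, §1.1 (vector identities)] [cite: KochNadirashviliSereginSverak2009, Lemma 3.1 (arXiv p. 7)]
-/

-- the summit and its single sub-problem share the name (CONVENTIONS §1)
set_option linter.dupNamespace false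

noncomputable section

namespace Summit.NavierStokesRegularity.NavierStokesRegularity.Theorems.PoloidalLiouville.CentreJet

open Set Function
open Literature.Analysis.FluidPDE (cross curl IsClassicalNSSolutionOn)

/-- ℝ³. -/
abbrev E3 : Type := EuclideanSpace ℝ (Fin 3)

/-- `V` is unthreaded about `x₀`: its vortex lines lie on the spheres about `x₀` (1222's hypothesis, frozen time).
[sketch l.64, verbatim] -/
def IsUnthreadedAbout (x₀ : E3) (V : E3 → E3) : Prop :=
  ∀ x, inner ℝ (x - x₀) (curl V x) = 0

/-- Classical steady Navier–Stokes on an open set `U` (`ν = 1`, no force): `(V·∇)V + ∇p = ΔV`, `div V = 0` on `U`.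
[sketch l.68, verbatim] -/
def IsSteadyNSOn (U : Set E3) (V : E3 → E3) (p : E3 → ℝ) : Prop :=
  ContDiffOn ℝ 3 V U ∧ ContDiffOn ℝ 1 p U ∧ (∀ x ∈ U, Literature.Analysis.FluidPDE.VectorCalculus.divergence V x = 0) ∧
    ∀ x ∈ U, fderiv ℝ V x (V x) + gradient p x = Laplacian.laplacian V x

/-- (E1, S — kinematics of the centre) If `V ∈ C³` is unthreaded about `x₀` then at the centre the vorticity VANISHES,
its gradient is SKEW (`∇ω(x₀) y = c × y`, `c = ½ curl ω (x₀)`), and its Laplacian vanishes: orders 1, 2, 3 of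
`⟪y, ω(x₀ + y)⟫ ≡ 0` (`Δ(⟪y, ω₂(y)⟫) = 2 div ω₂ + ⟪y, Δω₂⟫`).  [sketch l.77, verbatim; kernel: `CentreJet.centreVorticityJet`] -/
def CentreVorticityJet : Prop :=
  ∀ (V : E3 → E3) (x₀ : E3), ContDiff ℝ 3 V → IsUnthreadedAbout x₀ V →
    curl V x₀ = 0 ∧ (∀ y : E3, inner ℝ y (fderiv ℝ (curl V) x₀ y) = 0) ∧ Laplacian.laplacian (curl V) x₀ = 0

/-- (E3, S — finite-dimensional algebra behind the degree-2 law) If `c ≠ 0` and `M` is a symmetric endomorphism of `ℝ³`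
with `det(y, c, My) = 0` for all `y`, then `M` is ZONAL about `c`: `M = λ·𝟙 + μ·c ⊗ c`.  Applied to
`M = sym ∇V(x₀) − β·Q` (`P₂ = 2 det(y, c, (S − βQ)y)`, `Q` the quadratic toroidal potential `T₂(y) = ⟪y, Qy⟫`,
`V(x₀) = β c/‖c‖`): the strain at the centre is slaved to the (free, possibly non-zonal) quadratic vorticity datum.
[sketch l.100, verbatim; kernel: `CentreJet.centreStrainLawAlgebra`] -/
def CentreStrainLawAlgebra : Prop :=
  ∀ (c : E3) (M : E3 →L[ℝ] E3), c ≠ 0 → (∀ a b : E3, inner ℝ (M a) b = inner ℝ a (M b)) →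
    (∀ y : E3, inner ℝ y (cross c (M y)) = 0) →
    ∃ l μ : ℝ, ∀ y : E3, M y = l • y + (μ * inner ℝ c y) • c

/-- (R3, S — the degenerate tail's trivial piece) If the vorticity of a bounded classical steady flow vanishes identically,
the flow is constant (`V = ∇φ`, `φ` harmonic with bounded gradient; Liouville).
[sketch l.266, verbatim; kernel: `CentreJet.irrotationalSteadyLiouville`, p677698] -/
def IrrotationalSteadyLiouville : Prop :=
  ∀ (V : E3 → E3) (p : E3 → ℝ), IsSteadyNSOn univ V p → (∃ B : ℝ, ∀ x, ‖V x‖ ≤ B) → (∀ x, curl V x = 0) →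
    ∃ b : E3, ∀ x, V x = b

/-- The zonal endomorphism `λ·𝟙 + μ·c ⊗ c` does satisfy `det(y, c, My) = 0` (converse direction of E3).
[sketch l.301, verbatim; kernel: `CentreJet.zonalSatisfiesStrainLaw`, p677698] -/
def ZonalSatisfiesStrainLaw : Prop :=
  ∀ (c y : E3) (l μ : ℝ), inner ℝ y (cross c (l • y + (μ * inner ℝ c y) • c)) = 0

/-- (E2, S — the degree-1 law, NEW) **Centre drift law.** For a classical steady Navier–Stokes flow on `ℝ³` unthreaded about
`x₀`: `V(x₀) × ΔV(x₀) = 0` — the velocity at the centre is parallel to `curl ω = −ΔV` there (equivalently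
`∇ω(x₀) · V(x₀) = 0`).  Proof: vorticity equation at `x₀` with E1: `(V·∇)ω = (ω·∇)V + Δω = 0` at `x₀`, and
`(V·∇)ω(x₀) = c × V(x₀)`, `c = ½ curl curl V (x₀) = −½ ΔV(x₀)` (`div V = 0`).  It is the degree-1 component `b × c = 0`
of the loop law and survives for unthreaded EVOLUTIONS (`∂ₜω(x₀) = 0`): `CentreDriftLawEvolution`.
[sketch l.86, verbatim; kernel: `CentreJet.centreDriftLaw`] -/
def CentreDriftLaw : Prop :=
  ∀ (V : E3 → E3) (p : E3 → ℝ) (x₀ : E3), IsSteadyNSOn univ V p → IsUnthreadedAbout x₀ V →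
    cross (V x₀) (Laplacian.laplacian V x₀) = 0

/-- (E2′, S) The same law along an unthreaded classical EVOLUTION (`ν = 1`, no force) on `[t₀, t₁)`.
[sketch l.91, verbatim; kernel: `CentreJet.centreDriftLawEvolution`] -/
def CentreDriftLawEvolution : Prop :=
  ∀ (u : ℝ → E3 → E3) (p : ℝ → E3 → ℝ) (x₀ : E3) (t₀ t₁ : ℝ), t₀ < t₁ →
    IsClassicalNSSolutionOn (Ico t₀ t₁) 1 0 u p → (∀ t ∈ Ico t₀ t₁, IsUnthreadedAbout x₀ (u t)) →
    ∀ t ∈ Ico t₀ t₁, cross (u t x₀) (Laplacian.laplacian (u t) x₀) = 0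

/-- (E5, S — the steady vorticity equation in toroidal form) **Steady slaving identity.** For a classical steady flow on
`ℝ³` with `curl V = ∇T × (x − x₀)` off `x₀`, `T ∈ C⁴` off `x₀`: `∇(ΔT) × (x − x₀) = curl (curl V × V)` off `x₀`
(`Δ curl V = curl ΔV = curl((V·∇)V) = curl(ω × V)` and `Δ(∇T × y) = ∇(ΔT) × y`).  With the loop law (automatic when steady:
`⟪y, curl(ω × V)⟫ = ⟪y, Δω⟫ = Δ⟪y, ω⟫ − 2 div ω = 0`) this is the WHOLE steady system for the data `(T, φ)`.
[sketch l.121, verbatim; kernel: `CentreJet.steadySlavingIdentity`] -/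
def SteadySlavingIdentity : Prop :=
  ∀ (V : E3 → E3) (p : E3 → ℝ) (T : E3 → ℝ) (x₀ : E3), IsSteadyNSOn univ V p → ContDiff ℝ 4 V → ContDiffOn ℝ 4 T {x₀}ᶜ →
    (∀ x, x ≠ x₀ → curl V x = cross (gradient T x) (x - x₀)) →
    ∀ x, x ≠ x₀ →
      cross (gradient (fun z => Laplacian.laplacian T z) x) (x - x₀) = curl (fun z => cross (curl V z) (V z)) x

/-! ## Algebra of the `λ = 0` cell (sketch v1.3b §«Algebra of the λ = 0 cell», RESULTS §5c): the Euler top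
Three objects and the two algebra statements A1 / A2, typed over `MvPolynomial (Fin 3) ℝ`, bodies VERBATIM against
sketch l.248 / l.252 / l.256 (objects) and l.282 / l.292 (statements).  About the pure-strain base `V = S y` the loop
law at the lowest non-zero toroidal degree is linear, `P_{n+1} = 2 ⟪∇h_n, W⟫` with `W(y) = y × S y` the Euler-top
(polhode) field; A1 says the polynomial first integrals of `W` are `ℝ[|y|², ⟪y,Sy⟫]`, A2 that none of them beyond degree
2 is harmonic.  Kernel proofs: `CentreJet.eulerTopFirstIntegrals`, `CentreJet.noHarmonicPolhodeInvariant` (files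
`ThreadingFluxCentreJetEulerTopIntegrals.lean`, `ThreadingFluxCentreJetHarmonicPolhode.lean`; ns-wall-eng-5 g5). -/

open MvPolynomial in
/-- `|y|²` as a polynomial in three variables. [sketch l.248, verbatim] -/
def rhoPoly : MvPolynomial (Fin 3) ℝ := ∑ i : Fin 3, X i ^ 2

open MvPolynomial in
/-- `⟪y, S y⟫`, `S = diag a`, as a polynomial. [sketch l.252, verbatim] -/
def strainPoly (a : Fin 3 → ℝ) : MvPolynomial (Fin 3) ℝ := ∑ i : Fin 3, C (a i) * X i ^ 2

open MvPolynomial in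
/-- The Euler-top (polhode) vector field `W(y) = y × S y`, `S = diag a`, componentwise as polynomials.
[sketch l.256, verbatim] -/
def eulerTopField (a : Fin 3 → ℝ) : Fin 3 → MvPolynomial (Fin 3) ℝ :=
  ![C (a 2 - a 1) * X 1 * X 2, C (a 0 - a 2) * X 0 * X 2, C (a 1 - a 0) * X 0 * X 1]

open MvPolynomial in
/-- (A1, S/M — ALGEBRA, all degrees, PROVED ON PAPER; classical background: the Euler–Poinsot top has the two quadratic
integrals `|y|²`, `⟪y,Sy⟫` [Arnold 1989 §29]) **Polynomial first integrals of the Euler top.**  For pairwise distinct `aᵢ`,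
a real polynomial annihilated by the derivation `W·∇` is a polynomial in `|y|²` and `⟪y, S y⟫`.
[sketch l.282, verbatim; kernel: `CentreJet.eulerTopFirstIntegrals`] -/
def EulerTopFirstIntegrals : Prop :=
  ∀ a : Fin 3 → ℝ, Function.Injective a → ∀ T : MvPolynomial (Fin 3) ℝ,
    (∑ i : Fin 3, eulerTopField a i * pderiv i T = 0) →
    ∃ F : MvPolynomial (Fin 2) ℝ, T = aeval ![rhoPoly, strainPoly a] F

open MvPolynomial in
/-- (A2, S — ALGEBRA, PROVED ON PAPER) **No harmonic polhode invariant beyond degree 2.**  For pairwise distinct `aᵢ` with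
`Σ aᵢ = 0` (the strain of a divergence-free field is traceless; without it the degree-2 invariant is `s − (tr S/3)|y|²` instead of `s`),
if `F(|y|², ⟪y,Sy⟫)` is (formally) harmonic then `F = c₀ + c₁·s`.  With A1: the bracket `{·, ⟪y,Sy⟫}` is injective on harmonic
`n`-forms for every `n ≥ 3` (the rank table `2n+1`, `3 ≤ n ≤ 11`, of v1.3 is now a lemma for all `n`).
[sketch l.292, verbatim; kernel: `CentreJet.noHarmonicPolhodeInvariant`] -/
def NoHarmonicPolhodeInvariant : Prop :=
  ∀ a : Fin 3 → ℝ, Function.Injective a → ∑ i, a i = 0 → ∀ F : MvPolynomial (Fin 2) ℝ,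
    (∑ i : Fin 3, pderiv i (pderiv i (aeval ![rhoPoly, strainPoly a] F)) = 0) →
    ∃ c₀ c₁ : ℝ, F = C c₀ + C c₁ * X 1

/-! ### Appended (2026-08-29, v4): the Poincaré-lemma step E4, typed (body VERBATIM against sketch v1.3e l.119;
kernel proof `CentreJet.poloidalRepresentation`, `ThreadingFluxCentreJetPoloidalRepresentation.lean`, p684874; ns-wall-eng-7 g5). -/

open Literature.Analysis.FluidPDE.VectorCalculus (IsDivFree) in
/-- (E4, S — Poincaré lemma) **Poloidal velocity representation.** A `C²` divergence-free field with toroidal-exact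
vorticity `curl V = ∇T × (x − x₀)` off `x₀` is `V = T·(x − x₀) + ∇φ` off `x₀` (`curl (T y) = ∇T × y`, and
`ℝ³ ∖ {x₀}` is simply connected); `div V = 0` is exactly the last clause `Δφ = −(3 + (x − x₀)·∇)T` (v1.3: clause added,
V17-P4).  [sketch l.119, verbatim; kernel: `CentreJet.poloidalRepresentation`] -/
def PoloidalRepresentation : Prop :=
  ∀ (V : E3 → E3) (T : E3 → ℝ) (x₀ : E3), ContDiff ℝ 2 V → IsDivFree V → ContDiffOn ℝ 2 T {x₀}ᶜ →
    (∀ x, x ≠ x₀ → curl V x = cross (gradient T x) (x - x₀)) →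
    ∃ φ : E3 → ℝ, ContDiffOn ℝ 2 φ {x₀}ᶜ ∧ (∀ x, x ≠ x₀ → V x = T x • (x - x₀) + gradient φ x) ∧
      ∀ x, x ≠ x₀ → Laplacian.laplacian φ x = -(3 * T x + inner ℝ (x - x₀) (gradient T x))

/-! ### Appended (2026-08-29, v5): the card's lemma L1, typed (body VERBATIM against CentreJetSketch v1.5 l.317–324;
kernel proof `CentreJet.triaxialToroidalJetRigidity`, `ThreadingFluxCentreJetTriaxialRigidity.lean`; ns-wall-eng-7 g6). -/

/-- (L1, LEMMA — PROVED ON PAPER in v1.3b from A1 + A2 + the lowest-degree exactness; kernel: ns-wall-eng-7 g6, via the lowest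
Taylor term of `curl V` at the centre, the jet facts `div P = 0`, `⟪y,P⟫ = 0`, `ΔP = 0`, `⟪y, DP[Sy] − SP⟫ = 0`, and the
algebraic core `HarmonicTangent.harmonicTangentRigidity`) **Triaxial toroidal-jet rigidity.**  In the setting of C1″ but with
VANISHING toroidal 2-jet (`λ = 0`), the vorticity vanishes identically near `x₀` (the germ is a potential flow).
[sketch l.317, verbatim; kernel: `CentreJet.triaxialToroidalJetRigidity`] -/
def TriaxialToroidalJetRigidity : Prop :=
  ∀ (V : E3 → E3) (p : E3 → ℝ) (x₀ : E3) (ρ : ℝ), 0 < ρ →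
    AnalyticOnNhd ℝ V (Metric.ball x₀ ρ) → AnalyticOnNhd ℝ p (Metric.ball x₀ ρ) →
    IsSteadyNSOn (Metric.ball x₀ ρ) V p → (∀ x ∈ Metric.ball x₀ ρ, inner ℝ (x - x₀) (curl V x) = 0) →
    V x₀ = 0 → Laplacian.laplacian V x₀ = 0 →
    (∃ (u : Fin 3 → E3) (e : Fin 3 → ℝ), Orthonormal ℝ u ∧ Function.Injective e ∧ ∀ i, fderiv ℝ V x₀ (u i) = e i • u i) →
    fderiv ℝ (fderiv ℝ (curl V)) x₀ = 0 →
    ∀ x ∈ Metric.ball x₀ ρ, curl V x = 0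

/-! ### Appended (2026-08-29, v6): POLHODE FORCING — the `k = 2` companion of L1, typed at the critic's request (ns-wall-crit-1 g4
04:49:21Z «POLHODE-FORCING typing: yes»); binders = L1's VERBATIM minus the two hypotheses `Laplacian.laplacian V x₀ = 0` and
`fderiv ℝ (fderiv ℝ (curl V)) x₀ = 0`; kernel proof `CentreJet.polhodeForcing`, `ThreadingFluxCentreJetPolhodeForcing.lean`; ns-wall-eng-7 g6.
Not (yet) a sketch Prop: the custodian ns-idea-15 may adopt it verbatim. -/

/-- (POLHODE FORCING — the card's «`T₂ = λ⟪y,Sy⟫` is forced: vortex lines are polhodes» (docstring of C1″ `NoTriaxialPolhodeCentre`),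
plus «the type-N alternative is empty at a zero-drift triaxial centre».)  For a real-analytic steady Navier–Stokes flow on a ball, unthreaded
about the centre `x₀`, with `V(x₀) = 0` and a triaxial strain (orthonormal eigenbasis of `DV(x₀)` with three distinct eigenvalues): the
vorticity 1-jet vanishes, `D(curl V)(x₀) = 0` (so `ΔV(x₀) = −curl curl V(x₀) = 0` is automatic), and the vorticity 2-jet is a multiple of
the Euler-top (polhode) field of the strain, `D²(curl V)(x₀)(y, y) = μ · y × DV(x₀) y`.  (`μ = 0` is L1's cell, `μ ≠ 0` is C1″'s.)
[kernel: `CentreJet.polhodeForcing`] -/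
def PolhodeForcing : Prop :=
  ∀ (V : E3 → E3) (p : E3 → ℝ) (x₀ : E3) (ρ : ℝ), 0 < ρ →
    AnalyticOnNhd ℝ V (Metric.ball x₀ ρ) → AnalyticOnNhd ℝ p (Metric.ball x₀ ρ) →
    IsSteadyNSOn (Metric.ball x₀ ρ) V p → (∀ x ∈ Metric.ball x₀ ρ, inner ℝ (x - x₀) (curl V x) = 0) →
    V x₀ = 0 →
    (∃ (u : Fin 3 → E3) (e : Fin 3 → ℝ), Orthonormal ℝ u ∧ Function.Injective e ∧ ∀ i, fderiv ℝ V x₀ (u i) = e i • u i) →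
    fderiv ℝ (curl V) x₀ = 0 ∧
      ∃ μ : ℝ, ∀ y : E3, fderiv ℝ (fderiv ℝ (curl V)) x₀ y y = μ • cross y (fderiv ℝ V x₀ y)

/-! ### Appended (2026-08-29, v7): «EVOLUTION L1» — L1 along a classical Navier–Stokes evolution, typed (ns-wall-eng-7 g7; critic of
record ns-wall-crit-1 g5 05:58:44Z: no strike · M · information-grade; kernel proof `CentreJet.triaxialToroidalJetRigidity_evolution`,
`ThreadingFluxCentreJetTriaxialRigidityEvolution.lean`, which also proves the form on a general time set `S ⊆ closure (interior S)` of
unique differentiability, `…_of_timeSet`).  Binders shaped like L1's with `V := u t` at every time of the open interval; the steady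
equation is replaced by the tree's classical evolution class `IsClassicalNSSolutionOn (Ioo t₀ t₁) 1 0 u p` (joint `C^∞`, `ν = 1`, no
force — the class of E2′ `CentreDriftLawEvolution`); NO `Δ(u t)(x₀) = 0` binder (unused already in L1) and NO pressure analyticity (the proof
runs at the vorticity level).  Not (yet) a sketch Prop: the custodian ns-idea-15 may adopt it verbatim. -/

/-- («EVOLUTION L1») **Triaxial toroidal-jet rigidity along an evolution.**  Let `(u, p)` be a classical Navier–Stokes solution
(`ν = 1`, no force) on `(t₀, t₁) × ℝ³` such that at EVERY time `t ∈ (t₀, t₁)`: `u(t)` is real-analytic on the ball `B(x₀, ρ)`, unthreaded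
about `x₀` there (`⟪x − x₀, curl u(t)(x)⟫ = 0`), `u(t)(x₀) = 0`, `Du(t)(x₀)` has an orthonormal eigenbasis with three distinct eigenvalues
(frame and eigenvalues may depend on `t`), and the vorticity 2-jet vanishes, `D²(curl u(t))(x₀) = 0`.  Then `curl u(t) ≡ 0` on `B(x₀, ρ)`
for every `t ∈ (t₀, t₁)`.  Mechanism: at a time `t` where the spatial vanishing order `k` of `curl u(t)` at `x₀` is LEAST over the interval,
every lower Taylor term vanishes at all times, so `∂ₜ` is invisible below order `k` (`∂ₜ Dⁿ = Dⁿ ∂ₜ` for jointly smooth fields) and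
`⟪y, ∂ₜω⟫ = ∂ₜ⟪y, ω⟫ = 0`; the jet facts of L1 survive with the forcing `∂ₜω`, `k ≠ 2`, and the triaxial frame kills the lowest term.
[kernel: `CentreJet.triaxialToroidalJetRigidity_evolution`] -/
def TriaxialToroidalJetRigidityEvolution : Prop :=
  ∀ (u : ℝ → E3 → E3) (p : ℝ → E3 → ℝ) (x₀ : E3) (ρ t₀ t₁ : ℝ), 0 < ρ → t₀ < t₁ →
    IsClassicalNSSolutionOn (Ioo t₀ t₁) 1 0 u p →
    (∀ t ∈ Ioo t₀ t₁, AnalyticOnNhd ℝ (u t) (Metric.ball x₀ ρ)) →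
    (∀ t ∈ Ioo t₀ t₁, ∀ x ∈ Metric.ball x₀ ρ, inner ℝ (x - x₀) (curl (u t) x) = 0) →
    (∀ t ∈ Ioo t₀ t₁, u t x₀ = 0) →
    (∀ t ∈ Ioo t₀ t₁, ∃ (b : Fin 3 → E3) (e : Fin 3 → ℝ), Orthonormal ℝ b ∧ Function.Injective e ∧
      ∀ i, fderiv ℝ (u t) x₀ (b i) = e i • b i) →
    (∀ t ∈ Ioo t₀ t₁, fderiv ℝ (fderiv ℝ (curl (u t))) x₀ = 0) →
    ∀ t ∈ Ioo t₀ t₁, ∀ x ∈ Metric.ball x₀ ρ, curl (u t) x = 0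

end Summit.NavierStokesRegularity.NavierStokesRegularity.Theorems.PoloidalLiouville.CentreJet

end
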